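import Summits.ResolutionOfSingularities.ResolutionOfSingularities.Theorems.HomologicalConductorNoZenoRLipman12B
import HarnessLib

/-!
# Crux `NoZenoR` (stmt-ResolutionOfSingularities-19943) — Zariski's elimination of indeterminacies for REGULAR SURFACES
# in Lipman's literal form: domination of a proper birational model by a COMPOSITION OF POINT BLOW-UPS

Route `ResolutionOfSingularities/HomologicalConductor` (cell decomp-res, hand leafhand-res-homologicalconduct-18 g0).
OURS: AI-written proof over tree theorems, weaker than expert review; nothing here is a statement of the manuscript
under review (Hironaka 2017).  SUPPORT level, counted 0.  Def-free, no new named facts.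

`Lipman12B.Lipman1969_1_2_B_holds` (this hand) proves the tree's rendering of Lipman 1969, Prop. (1.2) proof, statement B),
whose conclusion («`j` a resolution») is WEAKER than print («`j` a product of quadratic transformations»).  Here is the
printed strength, over an arbitrary Noetherian integral base:

* `exists_isPointBlowupComposition_dominating` — for `S` Noetherian integral, `f : X → S` a resolution with `dim X ≤ 2`,
  `g : W → S` proper with `W` integral and an isomorphism over a dense open `U ⊆ S`: there are a COMPOSITION OF BLOWING
  UPS AT CLOSED POINTS `π : Z → X`, all centres lying over `X ∖ f⁻¹U` (the locus where the birational correspondence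
  `X ⇢ W` may be undefined), with `Z` regular and Noetherian, and `h : Z → W` with `h ≫ g = π ≫ f` (Zariski; Lipman 1969
  Thm. (26.1) for a regular surface, where no normalizations are needed).  Proof as in `Lipman1969_1_2_B_holds`:
  Stacks 081T/080E domination of `g` by `Bl_I(S)` with `V(I) = S ∖ U`, point-blow-up principalization of `I·𝒪_X`
  (`exists_isPointBlowupComposition_isLocallyPrincipal_noexc`, centres over `NP(I·𝒪_X) ⊆ V(I·𝒪_X) = f⁻¹V(I)`),
  `I·𝒪_Z ≠ 0`, `IsBlowup.lift`.
* `exists_isPointBlowupComposition_dominating_Spec` — the reading over `Spec R`, `R` a Noetherian domain, for `g` proper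
  birational: B) with `j` literally a composition of point blow-ups (addresses the `TODO(general form)` clause «B) with
  `j` literally a composite of point blow-ups» of `Resolution/Lipman1969DominationByQuadraticTransforms`).

No crux or summit statement is proved here.
-/

noncomputable section

-- single-problem summit: the doubled namespace component `ResolutionOfSingularities` is forced
set_option linter.dupNamespace false

open CategoryTheory AlgebraicGeometry TopologicalSpace IsLocalRing
open Literature.AlgebraicGeometry.Resolution Literature.AlgebraicGeometry.Morphisms
open Summit.ResolutionOfSingularities.ResolutionOfSingularities.Theorems.CampaignW46
open Scheme.IdealSheafData

universe u

namespace Summit.ResolutionOfSingularities.ResolutionOfSingularities.Theorems.NoZeno.Lipman12B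

/-- **Zariski's elimination of indeterminacies for a regular surface, by point blow-ups** (Lipman 1969, Thm. (26.1) /
statement B) of the proof of Prop. (1.2), printed strength): `S` Noetherian integral, `f : X → S` a resolution with
`dim X ≤ 2`, `g : W → S` proper, `W` integral, `g` an isomorphism over the dense open `U`; then some composition
`π : Z → X` of blowing ups at closed points lying over `X ∖ f⁻¹U`, with `Z` regular Noetherian, admits `h : Z → W` with
`h ≫ g = π ≫ f`. [cite: Lipman1969, Theorem (26.1) (p. 274) and Proposition (1.2), proof, statement B) (p. 200)];
[cite: StacksProject, Tag 081T]; [cite: ZariskiSamuel1960, Appendix 5] -/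
theorem exists_isPointBlowupComposition_dominating {S X W : Scheme.{u}} [IsNoetherian S] [IsIntegral S]
    (f : X ⟶ S) (hf : IsResolution f) (hdimX : topologicalKrullDim X ≤ 2)
    [IsIntegral W] (g : W ⟶ S) [IsProper g] (U : S.Opens) (hUd : Dense (U : Set S)) [IsIso (g ∣_ U)] :
    ∃ (Z : Scheme.{u}) (π : Z ⟶ X) (h : Z ⟶ W),
      IsPointBlowupComposition ((f ⁻¹ᵁ U : Set X)ᶜ) π ∧ Scheme.IsRegular Z ∧ IsNoetherian Z ∧ h ≫ g = π ≫ f := by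
  classical
  -- bookkeeping on `X`
  haveI : IsProper f := hf.isProper
  haveI : IsIntegral X := hf.isIntegral_source
  haveI : IsNoetherian X := by
    haveI : IsLocallyNoetherian X := LocallyOfFiniteType.isLocallyNoetherian f
    haveI : CompactSpace X := QuasiCompact.compactSpace_of_compactSpace f
    exact {}
  -- Step 1: `W` is dominated by a blowing up `b : S' → S` with centre `S ∖ U` (Stacks 081T/080E)
  have hUc : IsCompact ((U : Set S)) := NoetherianSpace.isCompact _
  obtain ⟨I, S', b, r, -, hsupp, hb, hrb, -⟩ := exists_isBlowup_dominating g U hUc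
  -- Step 2: principalize `I·𝒪_X` on the regular surface `X` by blowing up closed points
  obtain ⟨Z, π, hπ, hlp⟩ :=
    exists_isPointBlowupComposition_isLocallyPrincipal_noexc X hf.isRegular hdimX (I.comap f)
  obtain ⟨hZN, hZreg, -⟩ := IsPointBlowupComposition.invariants_noexc hπ hf.isRegular hdimX
  haveI := hZN
  haveI : IsIntegral Z := hπ.isIntegral inferInstance
  have hj : IsResolution π := ⟨hπ.isProper inferInstance, hπ.isBirational inferInstance, hZreg⟩
  -- the centres lie over `NP(I·𝒪_X) ⊆ V(I·𝒪_X) = f⁻¹(S ∖ U)`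
  have hT : (nonPrincipalLocus (I.comap f) : Set X) ⊆ ((f ⁻¹ᵁ U : Set X))ᶜ := by
    intro x hx hxU
    have hx' : x ∈ ((I.comap f).support : Set X) := nonPrincipalLocus_le_support _ hx
    rw [Scheme.IdealSheafData.support_comap, TopologicalSpace.Closeds.coe_preimage, Set.mem_preimage, hsupp] at hx'
    exact hx' hxU
  -- Step 3: `I·𝒪_Z ≠ 0` — some point of `Z` lies over `U = S ∖ V(I)`
  have hbir : IsBirational (π ≫ f) := hj.isBirational.comp hf.isBirational
  have hne : (I.comap f).comap π ≠ ⊥ := by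
    haveI := hbir.isDominant
    have hUne : ((U : Set S)).Nonempty := hUd.nonempty
    obtain ⟨_, hxU, ⟨z, rfl⟩⟩ :=
      (IsDominant.denseRange (f := π ≫ f)).inter_open_nonempty _ U.isOpen hUne
    intro h0
    have hz : z ∈ (((I.comap f).comap π).support : Set Z) := by
      rw [h0, Scheme.IdealSheafData.support_bot]; trivial
    rw [← Scheme.IdealSheafData.comap_comp, Scheme.IdealSheafData.support_comap,
      TopologicalSpace.Closeds.coe_preimage, Set.mem_preimage, hsupp] at hz
    exact hz hxU
  have hcart : IsEffectiveCartier (I.comap (π ≫ f)) := by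
    rw [Scheme.IdealSheafData.comap_comp]
    exact hlp.isEffectiveCartier_of_ne_bot hne
  -- Step 4: the universal property of the blowing up `b`
  refine ⟨Z, π, hb.lift (π ≫ f) hcart ≫ r, hπ.mono hT, hZreg, hZN, ?_⟩
  rw [Category.assoc, hrb, hb.lift_comp]

/-- **Statement B) of Lipman's proof of Prop. (1.2) at printed strength** — «`j` a product of quadratic transformations»:
for `R` a Noetherian domain, `f : X → Spec R` a resolution with `dim X ≤ 2` (e.g. `dim R ≤ 2`), `g : W → Spec R` proper
birational with `W` integral, there are a composition `j : Z → X` of blowing ups at closed points (`Z` regular; `j` is a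
resolution) and `h : Z → W` with `h ≫ g = j ≫ f`.
[cite: Lipman1969, Proposition (1.2), proof, statement B) (p. 200)]; [cite: StacksProject, Tag 081T] -/
theorem exists_isPointBlowupComposition_dominating_Spec {R : Type u} [CommRing R] [IsNoetherianRing R] [IsDomain R]
    {X : Scheme.{u}} (f : X ⟶ Spec (.of R)) (hf : IsResolution f) (hdimX : topologicalKrullDim X ≤ 2)
    {W : Scheme.{u}} [IsIntegral W] (g : W ⟶ Spec (.of R)) [IsProper g] (hg : IsBirational g) :
    ∃ (Z : Scheme.{u}) (j : Z ⟶ X) (h : Z ⟶ W) (T : Set X),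
      IsPointBlowupComposition T j ∧ IsResolution j ∧ h ≫ g = j ≫ f := by
  haveI : IsNoetherian (Spec (.of R)) := {}
  obtain ⟨U, hUd, -, hUiso⟩ := hg
  haveI := hUiso
  obtain ⟨Z, π, h, hπ, hZreg, hZN, hfac⟩ := exists_isPointBlowupComposition_dominating f hf hdimX g U hUd
  haveI : IsProper f := hf.isProper
  haveI : IsIntegral X := hf.isIntegral_source
  haveI : IsLocallyNoetherian X := LocallyOfFiniteType.isLocallyNoetherian f
  exact ⟨Z, π, h, _, hπ, ⟨hπ.isProper inferInstance, hπ.isBirational inferInstance, hZreg⟩, hfac⟩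

/-- **The same over a two-dimensional base**: for `R` a Noetherian domain of Krull dimension `≤ 2` the bound `dim X ≤ 2` is
automatic (`IsResolution.topologicalKrullDim_le`). [cite: Lipman1969, Proposition (1.2), proof, statement B) (p. 200)] -/
theorem exists_isPointBlowupComposition_dominating_of_ringKrullDim_le_two {R : Type u} [CommRing R]
    [IsNoetherianRing R] [IsDomain R] (hdim : ringKrullDim R ≤ 2)
    {X : Scheme.{u}} (f : X ⟶ Spec (.of R)) (hf : IsResolution f)
    {W : Scheme.{u}} [IsIntegral W] (g : W ⟶ Spec (.of R)) [IsProper g] (hg : IsBirational g) :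
    ∃ (Z : Scheme.{u}) (j : Z ⟶ X) (h : Z ⟶ W) (T : Set X),
      IsPointBlowupComposition T j ∧ IsResolution j ∧ h ≫ g = j ≫ f := by
  refine exists_isPointBlowupComposition_dominating_Spec f hf ?_ g hg
  refine hf.topologicalKrullDim_le.trans ?_
  change topologicalKrullDim (PrimeSpectrum R) ≤ 2
  rw [PrimeSpectrum.topologicalKrullDim_eq_ringKrullDim]
  exact hdim

end Summit.ResolutionOfSingularities.ResolutionOfSingularities.Theorems.NoZeno.Lipman12B

end
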